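/-
Origin: expansion seat `planner-pub-hodgecm-pv05-g2-0`, handover 2026-08-18T04:36:27Z (`HOME/pub-hodgecm-pv05-g2/lean/Pv05g2/KernelOperatorFDEquiv.lean`, md5 eccae633, 86 lines);
landed by the gen-6 packager in gate run 22 as `HodgeCM/PerL34/KernelOperatorFDEquiv.lean` (verbatim).
-/
/-
pub-hodgecm speedrun cell, prover pv05 — WIP module `Pv05.KernelOperatorFDEquiv` (proposed landing place
`HodgeCM/PerL34/KernelOperatorFDEquiv.lean`).  Imports: `Pv05.KernelOperatorFD` (pv05, run-21 queue; the packager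
rewrites this import to `HodgeCM.PerL34.KernelOperatorFD` — land AFTER it) and the LANDED `HodgeCM.PerL34.KernelOperator`
(pv05, run 19; only `integral_kernel_comp_eq` is used).  Mathlib otherwise.  Nothing posited, nothing cited.

# N21, second sentence, in the fundamental-domain model: `𝒯_{ω(h₀)Φ}(R(h₀)v) = 𝒯_Φ(v)` (tex l. 382–383)

The landed `KernelOperator.opT_comp_eq` proves the equivariance for continuous kernels on COMPACT `X × Y`; the cluster's
model of `[U(W)]` is a finite-measure fundamental domain with a bounded kernel (`KernelOperatorFD`, consumed by pv14
`P36FD`).  Here is the same equivariance for that operator: if `τ : Y → Y` preserves `ν` (the right translation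
`R(h₀)`, `dh` Haar) and the kernel transforms as `k'(x, y) = k(x, τ y)` (tex l. 383: `θ_{ω(h₀)Φ}(g, y) = θ_Φ(g, y h₀)`),
then `𝒯_{k'}(v ∘ τ) = 𝒯_k(v)` — `IsFDKernel.comp_right`, `evalT_comp_eq`, `opTC_comp_eq`, `opT_comp_eq`.  This is the
`invariance` field of pv06's `ArchCDatum` (carver v4 §9 S4) at the L²-kernel shell level, FD model.
-/
import Summits.HodgeConjecture.HodgeCM.PerL34.KernelOperatorFD
import Summits.HodgeConjecture.HodgeCM.PerL34.KernelOperator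

/-! PORT of `HodgeCM/PerL34/KernelOperatorFDEquiv.lean` (HodgeCMPerL run 81) — verbatim mechanical port; provenance in the PORT header line. -/

set_option autoImplicit false

noncomputable section

open MeasureTheory

namespace HodgeCM
namespace PerL34
namespace KernelOperatorFD

variable {X Y : Type*} [TopologicalSpace X] [MeasurableSpace Y]
  (ν : Measure Y) [IsFiniteMeasure ν] {k k' : X → Y → ℂ} {C C' : ℝ}

omit [TopologicalSpace X] in
/-- The translated kernel `(x, y) ↦ k(x, τ y)` is again an FD kernel with the same bound. -/
theorem IsFDKernel.comp_right [TopologicalSpace X] (hk : IsFDKernel k C) {τ : Y → Y} (hτ : Measurable τ) :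
    IsFDKernel (fun x y => k x (τ y)) C where
  cont y := hk.cont (τ y)
  meas x := (hk.meas x).comp hτ
  nonneg := hk.nonneg
  bound x y := hk.bound x (τ y)

omit [TopologicalSpace X] [IsFiniteMeasure ν] in
/-- **Equivariance, pointwise** (tex l. 382–383): `(𝒯_{k'}(v ∘ τ))(x) = (𝒯_k v)(x)` for `ν`-preserving `τ` and
`k'(x,y) = k(x, τ y)`; `v ∘ τ` is realised on `L²(ν)` by `Lp.compMeasurePreserving`. -/
theorem evalT_comp_eq {τ : Y → Y} (hτ : MeasurePreserving τ ν ν) (hτe : MeasurableEmbedding τ)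
    (hkk' : ∀ x y, k' x y = k x (τ y)) (v : Lp ℂ 2 ν) (x : X) :
    evalT k' ν (Lp.compMeasurePreserving τ hτ v) x = evalT k ν v x := by
  rw [evalT_def, evalT_def]
  calc ∫ y, k' x y * (Lp.compMeasurePreserving τ hτ v : Lp ℂ 2 ν) y ∂ν
      = ∫ y, k' x y * v (τ y) ∂ν := by
        apply integral_congr_ae
        filter_upwards [Lp.coeFn_compMeasurePreserving v hτ] with y hy
        rw [hy, Function.comp_apply]
    _ = ∫ y, k x y * v y ∂ν :=
        KernelOperator.integral_kernel_comp_eq hτ hτe (fun p => k p.1 p.2) (fun p => k' p.1 p.2)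
          (fun x y => hkk' x y) v x

section Compact

variable [FirstCountableTopology X] [CompactSpace X]

/-- Equivariance for `opTC : L²(ν) → C(X, ℂ)`. -/
theorem opTC_comp_eq {τ : Y → Y} (hτ : MeasurePreserving τ ν ν) (hτe : MeasurableEmbedding τ)
    (hk : IsFDKernel k C) (hk' : IsFDKernel k' C') (hkk' : ∀ x y, k' x y = k x (τ y)) (v : Lp ℂ 2 ν) :
    opTC ν hk' (Lp.compMeasurePreserving τ hτ v) = opTC ν hk v := by
  ext x
  exact evalT_comp_eq ν hτ hτe hkk' v x

variable [MeasurableSpace X] [BorelSpace X] (μ : Measure X) [IsFiniteMeasure μ]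

/-- **`𝒯_{ω(h₀)Φ}(R(h₀)v) = 𝒯_Φ(v)` in `L²(μ)`** (tex l. 382–383), FD model. -/
theorem opT_comp_eq {τ : Y → Y} (hτ : MeasurePreserving τ ν ν) (hτe : MeasurableEmbedding τ)
    (hk : IsFDKernel k C) (hk' : IsFDKernel k' C') (hkk' : ∀ x y, k' x y = k x (τ y)) (v : Lp ℂ 2 ν) :
    opT ν μ hk' (Lp.compMeasurePreserving τ hτ v) = opT ν μ hk v := by
  rw [opT_eq_toLp, opT_eq_toLp]
  congr 1
  ext x
  rw [evalTC_apply, evalTC_apply]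
  exact evalT_comp_eq ν hτ hτe hkk' v x

end Compact

end KernelOperatorFD
end PerL34
end HodgeCM

end
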